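import Summits.BirchSwinnertonDyer.BirchSwinnertonDyer.Theorems.SmallImageMuTransferMuTransferX9KolyvaginPackage
import HarnessLib

/-!
# The K6 `μ`-core under IMAGE FACTS instead of `ρ̄` not onto — part E: MU-TRANSFER-PROOF STEPS 2–4 (the
# registered stub `stub_stepsTwoFourOdd`) WITHOUT the binder `¬ W.HasSurjectiveModNGaloisRep p`
# (route `KatoDescentPotSupersingular`, U₀ parent item stmt-BirchSwinnertonDyer-19197 / U₀-ns node 19189;
# route-free helper)

Seat `bsd-potss-k9-c4` g14 (prover; cell `bsd-potss`); `--supports stmt-BirchSwinnertonDyer-19197 --as helper`;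
closes nothing.  HONEST FRAMING: BSD is not proved by any of this; nothing is booked; THEOREMS ONLY; the
mathematics and the proof text are the K6 cells' (`bsd-smallim` lur-b g2 p472462 `StepsTwoFour.stub_stepsTwoFourOdd_of`,
koly p474398 `TameClass.hKoly_holds` / `exists_kolyvaginPackage`; MU-TRANSFER-PROOF §§2–5).  k9-c4 g14's census of
the core: the binder `¬Surj` of the Steps-2–4 stub is VACUOUS — `hKoly_holds` is
`fun W _ _ p _ _ _ _ κ γ I hp2 hirr _ _ _ _ hES => exists_kolyvaginPackage W p κ γ I hp2 hirr hES` and the assembly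
only forwards it.  This file re-elaborates the assembly with the binder deleted:

* `StepsTwoFour.stub_stepsTwoFourIrr_of` — verbatim `stub_stepsTwoFourOdd_of` with `¬ W.HasSurjectiveModNGaloisRep p →`
  removed from the hypothesis `hKoly` and from the conclusion;
* `TameClass.stub_stepsTwoFourIrr_holds` — the stub WITHOUT the binder, for EVERY `E/ℚ` with `E[p]` irreducible
  and `p ≠ 2` (fed by `exists_kolyvaginPackage`), in particular on the 9-deficient rows at `p = 3`.

References: [MazurRubin2004] Prop. 1.3.2, §4.4, §5.3; [Rubin2000] Thm. 4.5.1, §4.4; [MilneADT2006] I Thm. 4.10;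
[Kato2004Asterisque] §13.
-/

set_option linter.dupNamespace false
set_option autoImplicit false

noncomputable section

open scoped NumberField ContRepresentation
open CategoryTheory Function Finset Polynomial
open Field IsDedekindDomain NumberField
open Literature.NumberTheory.GaloisRepresentations
open Literature.NumberTheory.GaloisRepresentations.IsNonarchimedeanLocalField
open Literature.NumberTheory.GaloisCohomology
open Literature.NumberTheory.EllipticCurves
open Literature.NumberTheory.EllipticCurves.Kato2004
open Literature.NumberTheory.EllipticCurves.Kato2004.EulerSystemValues
open Rat.HeightOneSpectrum
open Summit.BirchSwinnertonDyer.Rank1Residual.GaloisImage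

namespace Summit.BirchSwinnertonDyer.BirchSwinnertonDyer.Rank1Residual.StepsTwoFour

-- heartbeat head-room (lur-b g2 probe 2026-08-27: 145k < usage ≤ 160k of the default 200k): own budget line
set_option maxHeartbeats 400000 in
/-- **The registered stub `stub_stepsTwoFourOdd` of skeleton v6 (crux 19276) WITHOUT the binder `ρ̄_{E,p}` not
onto, from the Kolyvagin package `hKoly` (same binder dropped)** — twin of `stub_stepsTwoFourOdd_of`, lur-b's proof
text verbatim (the binder was introduced and passed to `hKoly` only; koly's `hKoly_holds` ignores it).  MU-TRANSFER-PROOF §5 STEPS 2–4: Chebotarev prime `q`, Kolyvagin class `κ_q`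
(hypothesis), Poitou–Tate + Lemma 1 (iii) (koly p457656), pair transport to the stub's Frobenius (x9 p455870).
[cite: MazurRubin2004, Prop. 1.3.2, §4.4 and §5.3] [cite: Rubin2000, Thm. 4.5.1 and §4.4]
[cite: MilneADT2006, Ch. I, Thm. 4.10(b)] -/
theorem stub_stepsTwoFourIrr_of
    (hKoly : ∀ (W : WeierstrassCurve ℚ) [W.IsElliptic] [W.IsGloballyMinimal] (p : ℕ) [Fact p.Prime]
      [ContinuousSMul ℤ_[p] (W.tateModule p)] [Module.Free ℤ_[p] (W.tateModule p)]
      [Module.Finite ℤ_[p] (W.tateModule p)] (κ : ZpExtension ℚ p) (γ : absoluteGaloisGroup ℚ)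
      (I : IwasawaH1Data W p κ γ), p ≠ 2 → W.HasIrreducibleModPGaloisRep p →
      κ.IsCyclotomic → κ.IsTopGenerator γ → ∀ (s : I.H), IsEulerSystemClass W p κ γ I s →
      ∃ (S₀ : Set (HeightOneSpectrum (𝓞 ℚ))), S₀.Finite ∧
      ∀ (a : ℕ) (κ' : κ.twistTower (W.torsionGaloisModule (p : ℤ))
          (fun P : WeierstrassCurve.geomTorsion W (p : ℤ) => AddSubgroup.torsionBy.nsmul P)),
        (κ.towerShift (W.torsionGaloisModule (p : ℤ))
          (fun P : WeierstrassCurve.geomTorsion W (p : ℤ) => AddSubgroup.torsionBy.nsmul P))^[a] κ' = I.redTower s →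
      ∀ (n e' : ℕ), e' + 1 = p ^ n →
      ∀ (Φ : contOneCocycles (W.modPTwist p κ (2 * e' + 1 + 1)).toTopRep),
        oneCocycleClass (W.modPTwist p κ (2 * e' + 1 + 1)).toTopRep Φ = κ'.1 (2 * e' + 1 + 1) →
      ∀ (q : HeightOneSpectrum (𝓞 ℚ)), q ∉ S₀ →
      ∀ [NeZero ((primesEquiv q : Nat.Primes) : ℕ)] [Fact (((primesEquiv q : Nat.Primes) : ℕ)).Prime]
        [NeZero ((((primesEquiv q : Nat.Primes) : ℕ) : ℕ) : q.adicCompletion ℚ)]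
        [(rootsOfUnityFixer ℚ ((primesEquiv q : Nat.Primes) : ℕ)).Normal]
        [Fintype (absoluteGaloisGroup ℚ ⧸ rootsOfUnityFixer ℚ ((primesEquiv q : Nat.Primes) : ℕ))],
      ∀ 𝔓 ∈ q.primesAbove, ∀ (Fr : absoluteGaloisGroup ℚ), IsArithFrobAt (𝓞 ℚ) Fr 𝔓 →
        WeierstrassCurve.galoisRepTorsion W p Fr = 1 → Fr ∈ κ.layerSubgroup n → Fr ∉ κ.layerSubgroup (n + 1) →
      -- (I0) the Euler-system tower class at level `J = 2e'+2` is unramified at `q`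
      galoisCohomology.localization (W.modPTwist p κ (2 * e' + 1 + 1)) (Sum.inr q) 1
          ((I.redTower s).1 (2 * e' + 1 + 1)) ∈
        DiscreteGaloisModule.unramifiedSubgroup (GaloisRep.toLocal q (W.modPTwist p κ (2 * e' + 1 + 1))) 1 ∧
      -- the KOLYVAGIN PACKAGE at `q`: a global cocycle `c` (the Kolyvagin class `κ_q` at level `J`), a tame
      -- generator `τq ∈ I_{ℚ_q}` read through `χ̄_ℓ`, a local arithmetic Frobenius `r`, and the VALUE identity
      ∃ (c : contOneCocycles (W.modPTwist p κ (2 * e' + 1 + 1)).toTopRep)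
        (τq r : absoluteGaloisGroup (q.adicCompletion ℚ)),
        τq ∈ absInertia (q.adicCompletion ℚ) ∧
        (∀ u : (ZMod ((primesEquiv q : Nat.Primes) : ℕ))ˣ,
          u ∈ Subgroup.zpowers (modPCyclotomicCharacterZMod (q.adicCompletion ℚ)
            ((primesEquiv q : Nat.Primes) : ℕ) τq)) ∧
        (∀ w : HeightOneSpectrum (𝓞 ℚ), w ≠ q → ((p : ℕ) : 𝓞 ℚ) ∉ w.asIdeal →
          GaloisRep.IsUnramifiedAt w (W.torsionGaloisModule (p : ℤ)) →
          galoisCohomology.localization (W.modPTwist p κ (2 * e' + 1 + 1)) (Sum.inr w) 1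
              (oneCocycleClass (W.modPTwist p κ (2 * e' + 1 + 1)).toTopRep c) ∈
            DiscreteGaloisModule.unramifiedSubgroup
              (GaloisRep.toLocal w (W.modPTwist p κ (2 * e' + 1 + 1))) 1) ∧
        galoisCohomology.localization (W.modPTwist p κ (2 * e' + 1 + 1)) (Sum.inr q) 1
            (oneCocycleClass (W.modPTwist p κ (2 * e' + 1 + 1)).toTopRep c) ∈
          DiscreteGaloisModule.transverseSubgroup (GaloisRep.toLocal q (W.modPTwist p κ (2 * e' + 1 + 1)))
            (CyclotomicField ((primesEquiv q : Nat.Primes) : ℕ) (q.adicCompletion ℚ)) ∧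
        IsAbsArithFrob r ∧
        ∃ U : Polynomial ℤ, ¬ ((p : ℤ) ∣ U.coeff 0) ∧
          c.1 (absGaloisRestrict ℚ (q.adicCompletion ℚ) τq) =
            Polynomial.aeval (shiftEnd (WeierstrassCurve.geomTorsion W (p : ℤ)) (2 * e' + 1 + 1)) U
              ((shiftEnd (WeierstrassCurve.geomTorsion W (p : ℤ)) (2 * e' + 1 + 1) ^ (e' + 1))
                ((shiftEnd (WeierstrassCurve.geomTorsion W (p : ℤ)) (2 * e' + 1 + 1) ^ a)
                  (Φ.1 (absGaloisRestrict ℚ (q.adicCompletion ℚ) r))))) :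
    ∀ (W : WeierstrassCurve ℚ) [W.IsElliptic] [W.IsGloballyMinimal] (p : ℕ) [Fact p.Prime] [ContinuousSMul ℤ_[p] (W.tateModule p)] [Module.Free ℤ_[p] (W.tateModule p)] [Module.Finite ℤ_[p] (W.tateModule p)] (κ : ZpExtension ℚ p) (γ : absoluteGaloisGroup ℚ) (I : IwasawaH1Data W p κ γ), p ≠ 2 → W.HasIrreducibleModPGaloisRep p → κ.IsCyclotomic → κ.IsTopGenerator γ → poitouTate_sum_localTatePairing_eq_zero ℚ → ∀ (s : I.H), IsEulerSystemClass W p κ γ I s → ∃ (S₀ : Set (HeightOneSpectrum (𝓞 ℚ))), S₀.Finite ∧ ∀ (a : ℕ) (κ' : κ.twistTower (W.torsionGaloisModule (p : ℤ)) (fun P : WeierstrassCurve.geomTorsion W (p : ℤ) => AddSubgroup.torsionBy.nsmul P)), (κ.towerShift (W.torsionGaloisModule (p : ℤ)) (fun P : WeierstrassCurve.geomTorsion W (p : ℤ) => AddSubgroup.torsionBy.nsmul P))^[a] κ' = I.redTower s → ∀ (n e' : ℕ), e' + 1 = p ^ n → ∀ (Φ : contOneCocycles (W.modPTwist p κ (2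 * e' + 1 + 1)).toTopRep), oneCocycleClass (W.modPTwist p κ (2 * e' + 1 + 1)).toTopRep Φ = κ'.1 (2 * e' + 1 + 1) → ∀ (ε : ℕ) (S₁ : Set (HeightOneSpectrum (𝓞 ℚ))) (Ψ : galoisCohomology (W.modPTwist p κ.invTwist (2 * e' + 1 + 1)) 1) (Ψc : contOneCocycles (W.modPTwist p κ.invTwist (2 * e' + 1 + 1)).toTopRep), S₀ ⊆ S₁ → oneCocycleClass (W.modPTwist p κ.invTwist (2 * e' + 1 + 1)).toTopRep Ψc = Ψ → (∀ v : HeightOneSpectrum (𝓞 ℚ), v ∉ S₁ → galoisCohomology.localization (W.modPTwist p κ.invTwist (2 * e' + 1 + 1)) (Sum.inr v) 1 Ψ ∈ DiscreteGaloisModule.unramifiedSubgroup (GaloisRep.toLocal v (W.modPTwist p κ.invTwist (2 * e' + 1 + 1))) 1) → (∀ v : HeightOneSpectrum (𝓞 ℚ), v ∈ S₁ → galoisCohomology.localization (W.modPTwist p κ.invTwist (2 * e' + 1 + 1)) (Sum.inr v) 1 ((κ.invTwist.shiftH1 (W.torsionGaloisModule (p : ℤ)) (fun P : WeierstrassCurve.geomTorsion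 W (p : ℤ) => AddSubgroup.torsionBy.nsmul P) (2 * e' + 1 + 1))^[ε] Ψ) = 0) → ∀ (eW : WeierstrassCurve.geomTorsion W (p : ℤ) → WeierstrassCurve.geomTorsion W (p : ℤ) → AlgebraicClosure ℚ) (hμ : ∀ S T, eW S T ^ p = 1) (hadd₁ : ∀ S₁' S₂' T, eW (S₁' + S₂') T = eW S₁' T * eW S₂' T) (hadd₂ : ∀ S T₁ T₂, eW S (T₁ + T₂) = eW S T₁ * eW S T₂), (∀ T, eW T T = 1) → (∀ T, (∀ S, eW S T = 1) → T = 0) → (∀ (σ : absoluteGaloisGroup ℚ) (S T : WeierstrassCurve.geomTorsion W (p : ℤ)), σ • eW S T = eW (σ • S) (σ • T)) → ∀ (q : HeightOneSpectrum (𝓞 ℚ)), q ∉ S₁ → ∀ 𝔓 ∈ q.primesAbove, ∀ (Fr : absoluteGaloisGroup ℚ), IsArithFrobAt (𝓞 ℚ) Fr 𝔓 → WeierstrassCurve.galoisRepTorsion W p Fr = 1 → Fr ∈ κ.layerSubgroup n → Fr ∉ κ.layerSubgroup (n + 1) → ∃ U : Polynomial ℤ, ¬ ((p : ℤ) ∣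 U.coeff 0) ∧ ∀ i : ℕ, i + ε < 2 * e' + 1 + 1 → convCoeff (weilPairingHom W p eW hμ hadd₁ hadd₂) (2 * e' + 1 + 1) i (Polynomial.aeval (shiftEnd (WeierstrassCurve.geomTorsion W (p : ℤ)) (2 * e' + 1 + 1)) U ((shiftEnd (WeierstrassCurve.geomTorsion W (p : ℤ)) (2 * e' + 1 + 1) ^ (e' + 1 + a)) (Φ.1 Fr))) (Ψc.1 Fr) = 0 := by
  intro W _ _ p _ _ _ _ κ γ I hp2 hirr hκ hγ hPTfact s hES
  have hp : p.Prime := Fact.out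
  haveI : NeZero p := ⟨hp.ne_zero⟩
  haveI : Finite (WeierstrassCurve.geomTorsion W (p : ℤ)) := finite_geomTorsion_of_neZero W p
  -- the producer's exceptional set and x9's set (off it: `v ∤ p`, good reduction, `E[p]` unramified)
  obtain ⟨S₀', hS₀'fin, hK⟩ := hKoly W p κ γ I hp2 hirr hκ hγ s hES
  obtain ⟨S₀'', hS₀''fin, hS₀''⟩ :=
    TorsionUnramified.exists_finite_isUnramifiedAt_torsionGaloisModule W (K := ℚ) (p := p) hp.ne_zero
  refine ⟨S₀' ∪ S₀'', hS₀'fin.union hS₀''fin, ?_⟩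
  intro a κ' hκ' n e' he' Φ hΦ ε S₁ Ψ Ψc hS hΨc hΨur hΨS eW hμ hadd₁ hadd₂ halt hnd hgal q hq 𝔓 h𝔓 Fr hFr
    hρ hFrn hFrn'
  have hq' : q ∉ S₀' := fun h => hq (hS (Or.inl h))
  have hoff : ∀ v ∉ S₁, ((p : ℕ) : 𝓞 ℚ) ∉ v.asIdeal ∧ W.HasGoodReductionAt v ∧
      GaloisRep.IsUnramifiedAt v (W.torsionGaloisModule (p : ℤ)) :=
    fun v hv => hS₀'' v fun h => hv (hS (Or.inr h))
  obtain ⟨hqp, -, hur⟩ := hoff q hq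
  -- the prime `ℓ` of `q`, instances at `q`
  haveI : NeZero ((primesEquiv q : Nat.Primes) : ℕ) := ⟨(primesEquiv q).2.ne_zero⟩
  haveI : Fact (((primesEquiv q : Nat.Primes) : ℕ)).Prime := ⟨(primesEquiv q).2⟩
  haveI : NeZero ((((primesEquiv q : Nat.Primes) : ℕ) : ℕ) : q.adicCompletion ℚ) := by
    haveI := charZero_adicCompletion q; exact NeZero.charZero
  haveI hN : (rootsOfUnityFixer ℚ ((primesEquiv q : Nat.Primes) : ℕ)).Normal :=
    KolyvaginTwist.normal_rootsOfUnityFixer _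
  haveI : CompactSpace (absoluteGaloisGroup ℚ) := absoluteGaloisGroup_compactSpace ℚ
  haveI : (rootsOfUnityFixer ℚ ((primesEquiv q : Nat.Primes) : ℕ)).FiniteIndex :=
    finiteIndex_of_isOpen_of_compactSpace _ (isOpen_rootsOfUnityFixer ℚ _)
  haveI : Fintype (absoluteGaloisGroup ℚ ⧸ rootsOfUnityFixer ℚ ((primesEquiv q : Nat.Primes) : ℕ)) :=
    Fintype.ofFinite _
  have hℓabs : Ideal.absNorm q.asIdeal = ((primesEquiv q : Nat.Primes) : ℕ) :=
    Literature.NumberTheory.LFunctions.absNorm_asIdeal_eq_primesEquiv q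
  haveI : Fact (Ideal.absNorm q.asIdeal).Prime := ⟨by rw [hℓabs]; exact (primesEquiv q).2⟩
  haveI : NeZero ((Ideal.absNorm q.asIdeal : ℕ) : q.adicCompletion ℚ) :=
    ⟨by rw [hℓabs]; exact NeZero.ne _⟩
  haveI : LocallyCompactSpace (absoluteGaloisGroup ℚ) := inferInstance
  haveI : CompactSpace (absoluteGaloisGroup (q.adicCompletion ℚ)) :=
    absoluteGaloisGroup_compactSpace (q.adicCompletion ℚ)
  haveI : LocallyCompactSpace (absoluteGaloisGroup (Place.Completion (Sum.inr q : Place ℚ))) :=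
    (inferInstance : LocallyCompactSpace (absoluteGaloisGroup (q.adicCompletion ℚ)))
  -- the Kolyvagin package at `q`
  obtain ⟨hI0, c, τq, r, hτq, hgen, hx, hcq, hr, U, hU0, hval⟩ :=
    hK a κ' hκ' n e' he' Φ hΦ q hq' 𝔓 h𝔓 Fr hFr hρ hFrn hFrn'
  -- `E`-splitness and depth of the local Frobenius `r`
  obtain ⟨hsplit, hρr, hrn, hrn'⟩ :=
    StepsTwoFourTransport.isSplit_and_depth_absGaloisRestrict_of_isArithFrobAt_rat W p κ hur hqp h𝔓 hFr hρ
      hFrn hFrn' hr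
  -- `p ∣ N(q) − 1`, `χ̄_{N q}` onto on inertia, `hgen` and `hcq` in the `absNorm` currency
  have hpl : p ∣ Ideal.absNorm q.asIdeal - 1 :=
    SplitPrime.dvd_absNorm_sub_one_of_isAbsArithFrob_of_galoisRepTorsion_eq_one W p hqp hr hρr
  have hχI : ∀ u : (ZMod (Ideal.absNorm q.asIdeal))ˣ, ∃ t ∈ absInertia (q.adicCompletion ℚ),
      modPCyclotomicCharacterZMod (q.adicCompletion ℚ) (Ideal.absNorm q.asIdeal) t = u := fun u =>
    Rat.exists_mem_absInertia_adicCompletion_modPCyclotomicCharacterZMod_eq_of_absNorm_eq q rfl u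
  have hgen' : ∀ u : (ZMod (Ideal.absNorm q.asIdeal))ˣ,
      u ∈ Subgroup.zpowers (modPCyclotomicCharacterZMod (q.adicCompletion ℚ) (Ideal.absNorm q.asIdeal) τq) := by
    have key : ∀ (m : ℕ) [Fact m.Prime] [NeZero ((m : ℕ) : q.adicCompletion ℚ)],
        m = ((primesEquiv q : Nat.Primes) : ℕ) →
        ∀ u : (ZMod m)ˣ, u ∈ Subgroup.zpowers (modPCyclotomicCharacterZMod (q.adicCompletion ℚ) m τq) := by
      intro m _ _ hm; subst hm; exact hgen
    exact key _ hℓabs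
  have hcq' := (TameSeams.mem_transverseSubgroup_cyclotomicField_absNorm_iff q _ _).2 hcq
  -- the Weil pairing datum and the Poitou–Tate invariants
  have he := StepFour.weilPairingHom_torsionGaloisModule_smul W p eW hμ hadd₁ hadd₂ hgal
  have hnd' := weilPairingHom_right_nondegenerate W p eW hμ hadd₁ hadd₂ hnd
  have hsurj := weilPairingHom_right_surjective W p eW hμ hadd₁ hadd₂ hnd
  obtain ⟨ι, v₀, w₀, hι, h1⟩ := exists_iota_weilPairingHom_eq_one W p eW hμ hadd₁ hadd₂ hnd
  obtain ⟨inv, hperf, hPT⟩ := hPTfact p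
  -- the Selmer-side clauses of `Ψ = [Ψc]`
  have hΨ : ∀ v ∉ S₁, galoisCohomology.localization (W.modPTwist p κ.invTwist (2 * e' + 1 + 1)) (Sum.inr v) 1
      (oneCocycleClass (W.modPTwist p κ.invTwist (2 * e' + 1 + 1)).toTopRep Ψc) ∈
      DiscreteGaloisModule.unramifiedSubgroup
        (GaloisRep.toLocal v (W.modPTwist p κ.invTwist (2 * e' + 1 + 1))) 1 := fun v hv => by
    rw [hΨc]; exact hΨur v hv
  have hΨS' : ∀ v ∈ S₁, galoisCohomology.localization (W.modPTwist p κ.invTwist (2 * e' + 1 + 1)) (Sum.inr v) 1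
      ((κ.invTwist.shiftH1 (W.torsionGaloisModule (p : ℤ))
        (fun P : WeierstrassCurve.geomTorsion W (p : ℤ) => AddSubgroup.torsionBy.nsmul P) (2 * e' + 1 + 1))^[ε]
        (oneCocycleClass (W.modPTwist p κ.invTwist (2 * e' + 1 + 1)).toTopRep Ψc)) = 0 := fun v hv => by
    rw [hΨc]; exact hΨS v hv
  have hxS : ∀ v ∉ S₁, v ≠ q → galoisCohomology.localization (W.modPTwist p κ (2 * e' + 1 + 1)) (Sum.inr v) 1
      (oneCocycleClass (W.modPTwist p κ (2 * e' + 1 + 1)).toTopRep c) ∈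
      DiscreteGaloisModule.unramifiedSubgroup (GaloisRep.toLocal v (W.modPTwist p κ (2 * e' + 1 + 1))) 1 :=
    fun v hv hvq => hx v hvq (hoff v hv).1 (hoff v hv).2.2
  -- depth bookkeeping: `n + 1 ≤ J`
  have hnJ : n + 1 ≤ 2 * e' + 1 + 1 := by
    have := Nat.lt_pow_self hp.one_lt (n := n); omega
  -- STEP 4 ⊕ Lemma 1 (iii) at `(c, τq, r)` (koly p457656)
  have h4 : ∀ i, i + ε < 2 * e' + 1 + 1 →
      convCoeff (weilPairingHom W p eW hμ hadd₁ hadd₂) (2 * e' + 1 + 1) i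
        (c.1 (absGaloisRestrict ℚ (q.adicCompletion ℚ) τq))
        (Ψc.1 (absGaloisRestrict ℚ (q.adicCompletion ℚ) r)) = 0 := by
    unfold WeierstrassCurve.modPTwist at c hxS hcq' Ψc hΨ hΨS' ⊢
    exact LocalSplitPrime.convCoeff_eq_zero_of_transverse_of_unramified (W.torsionGaloisModule (p : ℤ))
      (W.torsionGaloisModule (p : ℤ)) (fun P => AddSubgroup.torsionBy.nsmul P)
      (fun P => AddSubgroup.torsionBy.nsmul P) κ (2 * e' + 1 + 1) q hp2 he hnd' hsurj ι hι h1 hperf hPT S₁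
      hq (fun v hv => (hoff v hv).1) (fun v hv => (hoff v hv).2.2) hur hpl hχI hr hsplit hsplit hnJ hrn hrn'
      hτq hgen' c hxS hcq' Ψc hΨ ε hΨS'
  -- the unramified avatar `Φ' = S^a ∘ Φ` of `(I.redTower s)_J`
  set Φ' := κ.shiftPowCocycle (W.torsionGaloisModule (p : ℤ))
    (fun P : WeierstrassCurve.geomTorsion W (p : ℤ) => AddSubgroup.torsionBy.nsmul P) (2 * e' + 1 + 1) a Φ
    with hΦ'def
  have hΦ'cl : oneCocycleClass (W.modPTwist p κ (2 * e' + 1 + 1)).toTopRep Φ' =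
      (I.redTower s).1 (2 * e' + 1 + 1) := by
    change oneCocycleClass (κ.twistModP (W.torsionGaloisModule (p : ℤ))
      (fun P : WeierstrassCurve.geomTorsion W (p : ℤ) => AddSubgroup.torsionBy.nsmul P) (2 * e' + 1 + 1)).toTopRep
      (κ.shiftPowCocycle (W.torsionGaloisModule (p : ℤ))
        (fun P : WeierstrassCurve.geomTorsion W (p : ℤ) => AddSubgroup.torsionBy.nsmul P) (2 * e' + 1 + 1) a Φ) = _
    rw [← ZpExtension.shiftH1_iterate_oneCocycleClass, ← hκ', ZpExtension.towerShift_iterate_apply_coe]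
    exact congrArg _ hΦ
  have hΦ'I : ∀ i ∈ absInertia (q.adicCompletion ℚ), Φ'.1 (absGaloisRestrict ℚ (q.adicCompletion ℚ) i) = 0 :=
    fun i hi => StepFour.apply_absGaloisRestrict_eq_zero_of_localization_mem_unramified κ
      (W.torsionGaloisModule (p : ℤ)) (fun P => AddSubgroup.torsionBy.nsmul P) (2 * e' + 1 + 1) q hur hqp Φ'
      (by rw [← hΦ'cl] at hI0; exact hI0) hi
  have hΨI : ∀ i ∈ absInertia (q.adicCompletion ℚ), Ψc.1 (absGaloisRestrict ℚ (q.adicCompletion ℚ) i) = 0 :=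
    fun i hi => StepFour.apply_absGaloisRestrict_eq_zero_of_localization_mem_unramified κ.invTwist
      (W.torsionGaloisModule (p : ℤ)) (fun P => AddSubgroup.torsionBy.nsmul P) (2 * e' + 1 + 1) q hur hqp Ψc
      (hΨ q hq) hi
  -- the pair statement at the local Frobenius `r`
  have hloc : ∃ U : Polynomial ℤ, ¬ ((p : ℤ) ∣ U.coeff 0) ∧ ∀ i, i + ε < 2 * e' + 1 + 1 →
      convCoeff (weilPairingHom W p eW hμ hadd₁ hadd₂) (2 * e' + 1 + 1) i
        (Polynomial.aeval (shiftEnd (WeierstrassCurve.geomTorsion W (p : ℤ)) (2 * e' + 1 + 1)) U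
          ((shiftEnd (WeierstrassCurve.geomTorsion W (p : ℤ)) (2 * e' + 1 + 1) ^ (e' + 1))
            (Φ'.1 (absGaloisRestrict ℚ (q.adicCompletion ℚ) r))))
        (Ψc.1 (absGaloisRestrict ℚ (q.adicCompletion ℚ) r)) = 0 := by
    refine ⟨U, hU0, fun i hi => ?_⟩
    have hval' : Polynomial.aeval (shiftEnd (WeierstrassCurve.geomTorsion W (p : ℤ)) (2 * e' + 1 + 1)) U
          ((shiftEnd (WeierstrassCurve.geomTorsion W (p : ℤ)) (2 * e' + 1 + 1) ^ (e' + 1))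
            (Φ'.1 (absGaloisRestrict ℚ (q.adicCompletion ℚ) r))) =
        c.1 (absGaloisRestrict ℚ (q.adicCompletion ℚ) τq) := by
      rw [hval, hΦ'def, ZpExtension.shiftPowCocycle_apply]
    rw [hval']
    exact h4 i hi
  -- equivariance of `e` in the `•` spelling, and the transport to the stub's `(𝔓, Fr)` (x9 p455870)
  have he' : ∀ (g : absoluteGaloisGroup ℚ) (m m' : WeierstrassCurve.geomTorsion W (p : ℤ)),
      weilPairingHom W p eW hμ hadd₁ hadd₂ (g • m) (g • m') =
        DiscreteGaloisModule.mu ℚ p g (weilPairingHom W p eW hμ hadd₁ hadd₂ m m') := fun g m m' => by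
    rw [← WeierstrassCurve.torsionGaloisModule_apply_apply, ← WeierstrassCurve.torsionGaloisModule_apply_apply]
    exact he g m m'
  have hJm : 2 * e' + 1 + 1 ≤ (e' + 1) + p ^ n := by omega
  obtain ⟨U', hU'0, hU'⟩ :=
    StepsTwoFourTransport.exists_forall_convCoeff_aeval_eq_zero_of_isAbsArithFrob W p κ
      (DiscreteGaloisModule.mu ℚ p) he' hnJ hJm Φ' Ψc hqp hur hΦ'I hΨI hr hloc h𝔓 hFr hρ hFrn hFrn'
  have hpow : ∀ x : Fin (2 * e' + 1 + 1) → WeierstrassCurve.geomTorsion W (p : ℤ),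
      (shiftEnd (WeierstrassCurve.geomTorsion W (p : ℤ)) (2 * e' + 1 + 1) ^ (e' + 1 + a)) x =
        (shiftEnd (WeierstrassCurve.geomTorsion W (p : ℤ)) (2 * e' + 1 + 1) ^ (e' + 1))
          ((shiftEnd (WeierstrassCurve.geomTorsion W (p : ℤ)) (2 * e' + 1 + 1) ^ a) x) := fun x => by
    rw [pow_add, Module.End.mul_apply]
  refine ⟨U', hU'0, fun i hi => ?_⟩
  have h := hU' i hi
  rw [hΦ'def, ZpExtension.shiftPowCocycle_apply] at h
  rw [hpow]
  exact h



end Summit.BirchSwinnertonDyer.BirchSwinnertonDyer.Rank1Residual.StepsTwoFour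

namespace Summit.BirchSwinnertonDyer.BirchSwinnertonDyer.Rank1Residual.TameClass

-- heartbeat head-room for the statement (same budget line as the sibling)
set_option maxHeartbeats 400000 in
/-- **MU-TRANSFER-PROOF STEPS 2–4 (the registered stub `stub_stepsTwoFourOdd`) WITHOUT `ρ̄_{E,p}` not onto**, for
every `E/ℚ` with `E[p]` irreducible, `p ≠ 2`: `StepsTwoFour.stub_stepsTwoFourIrr_of` fed with koly's
`exists_kolyvaginPackage` (which never used the binder). [cite: Kato2004Asterisque, §13.1 (13.1.1), Ex. 13.3 and §17.13]
[cite: Rubin2000, Thm. 4.5.1 and §4.4] [cite: MazurRubin2004, §5.3] -/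
theorem stub_stepsTwoFourIrr_holds :
    ∀ (W : WeierstrassCurve ℚ) [W.IsElliptic] [W.IsGloballyMinimal] (p : ℕ) [Fact p.Prime] [ContinuousSMul ℤ_[p] (W.tateModule p)] [Module.Free ℤ_[p] (W.tateModule p)] [Module.Finite ℤ_[p] (W.tateModule p)] (κ : ZpExtension ℚ p) (γ : absoluteGaloisGroup ℚ) (I : IwasawaH1Data W p κ γ), p ≠ 2 → W.HasIrreducibleModPGaloisRep p → κ.IsCyclotomic → κ.IsTopGenerator γ → poitouTate_sum_localTatePairing_eq_zero ℚ → ∀ (s : I.H), IsEulerSystemClass W p κ γ I s → ∃ (S₀ : Set (HeightOneSpectrum (𝓞 ℚ))), S₀.Finite ∧ ∀ (a : ℕ) (κ' : κ.twistTower (W.torsionGaloisModule (p : ℤ)) (fun P : WeierstrassCurve.geomTorsion W (p : ℤ) => AddSubgroup.torsionBy.nsmul P)), (κ.towerShift (W.torsionGaloisModule (p : ℤ)) (fun P : WeierstrassCurve.geomTorsion W (p : ℤ) => AddSubgroup.torsionBy.nsmul P))^[a] κ' = I.redTower s → ∀ (n e' : ℕ), e' + 1 = p ^ n → ∀ (Φ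 : contOneCocycles (W.modPTwist p κ (2 * e' + 1 + 1)).toTopRep), oneCocycleClass (W.modPTwist p κ (2 * e' + 1 + 1)).toTopRep Φ = κ'.1 (2 * e' + 1 + 1) → ∀ (ε : ℕ) (S₁ : Set (HeightOneSpectrum (𝓞 ℚ))) (Ψ : galoisCohomology (W.modPTwist p κ.invTwist (2 * e' + 1 + 1)) 1) (Ψc : contOneCocycles (W.modPTwist p κ.invTwist (2 * e' + 1 + 1)).toTopRep), S₀ ⊆ S₁ → oneCocycleClass (W.modPTwist p κ.invTwist (2 * e' + 1 + 1)).toTopRep Ψc = Ψ → (∀ v : HeightOneSpectrum (𝓞 ℚ), v ∉ S₁ → galoisCohomology.localization (W.modPTwist p κ.invTwist (2 * e' + 1 + 1)) (Sum.inr v) 1 Ψ ∈ DiscreteGaloisModule.unramifiedSubgroup (GaloisRep.toLocal v (W.modPTwist p κ.invTwist (2 * e' + 1 + 1))) 1) → (∀ v : HeightOneSpectrum (𝓞 ℚ), v ∈ S₁ → galoisCohomology.localization (W.modPTwist p κ.invTwist (2 * e' + 1 + 1)) (Sum.inr v) 1 ((κ.invTwist.shiftH1 (W.torsionGaloisModule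 (p : ℤ)) (fun P : WeierstrassCurve.geomTorsion W (p : ℤ) => AddSubgroup.torsionBy.nsmul P) (2 * e' + 1 + 1))^[ε] Ψ) = 0) → ∀ (eW : WeierstrassCurve.geomTorsion W (p : ℤ) → WeierstrassCurve.geomTorsion W (p : ℤ) → AlgebraicClosure ℚ) (hμ : ∀ S T, eW S T ^ p = 1) (hadd₁ : ∀ S₁' S₂' T, eW (S₁' + S₂') T = eW S₁' T * eW S₂' T) (hadd₂ : ∀ S T₁ T₂, eW S (T₁ + T₂) = eW S T₁ * eW S T₂), (∀ T, eW T T = 1) → (∀ T, (∀ S, eW S T = 1) → T = 0) → (∀ (σ : absoluteGaloisGroup ℚ) (S T : WeierstrassCurve.geomTorsion W (p : ℤ)), σ • eW S T = eW (σ • S) (σ • T)) → ∀ (q : HeightOneSpectrum (𝓞 ℚ)), q ∉ S₁ → ∀ 𝔓 ∈ q.primesAbove, ∀ (Fr : absoluteGaloisGroup ℚ), IsArithFrobAt (𝓞 ℚ) Fr 𝔓 → WeierstrassCurve.galoisRepTorsion W p Fr = 1 → Fr ∈ κ.layerSubgroup n → Fr ∉ κ.layerSubgroup (n + 1) → ∃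 U : Polynomial ℤ, ¬ ((p : ℤ) ∣ U.coeff 0) ∧ ∀ i : ℕ, i + ε < 2 * e' + 1 + 1 → convCoeff (weilPairingHom W p eW hμ hadd₁ hadd₂) (2 * e' + 1 + 1) i (Polynomial.aeval (shiftEnd (WeierstrassCurve.geomTorsion W (p : ℤ)) (2 * e' + 1 + 1)) U ((shiftEnd (WeierstrassCurve.geomTorsion W (p : ℤ)) (2 * e' + 1 + 1) ^ (e' + 1 + a)) (Φ.1 Fr))) (Ψc.1 Fr) = 0 :=
  StepsTwoFour.stub_stepsTwoFourIrr_of fun W _ _ p _ _ _ _ κ γ I hp2 hirr _ _ _ hES =>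
    exists_kolyvaginPackage W p κ γ I hp2 hirr hES

end Summit.BirchSwinnertonDyer.BirchSwinnertonDyer.Rank1Residual.TameClass

end
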